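import Summits.BirchSwinnertonDyer.Rank1Residual.X11b.BDPRouteErratumDataRecord
import Summits.BirchSwinnertonDyer.Rank1Residual.X11b.RouteR1HalvesAllFrames
import HarnessLib

/-!
# X11b, route R1 at `p ≥ 5` — H2∃⁻, the value at `𝟙` AS ITS OWN TYPED INPUT at route R1's erratum
# data (`R1.BDPValueCoreFrameOnTree W p`): the erratum road's records WITHOUT the semistable
# hypothesis, the value supplied by THEOREM C♯ of cell bsd-stepL instead of Cas18 Thm. 3.2

HONEST FRAMING (cell `bsd-stepL`, run/shared/lean/pub/bsd-stepL/, seat `bsd-stepL-bdp` g6; the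
Rank1Residual library files keep the b2b-bsdres framing verbatim): the goal is to DELETE the
COMBINATION-SHAPED residual classes of the Birch–Swinnerton-Dyer formula for ALL analytic-rank `≤ 1`
elliptic curves over `ℚ` — "full BSD formula for every rank `≤ 1` curve in class `C`" assembled
STRICTLY from published theorems — so that the rank-`≤ 1` remainder becomes exactly the
CONSTRUCTION-SHAPED classes, which are TYPED (missing-input `Prop`s), NOT attempted. This is not
"finishing BSD". Class X11b (`r_an = 1`, `p ∥ N`, `E[p]` irreducible), route R1 (the erratum road) at
`p ≥ 5`; no claim beyond the stated class and data; X11b's label does not change; NOTHING is booked.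

ONE `Prop`-valued SHAPE with body (nothing asserted) and THEOREMS (no named fact, no `sorry`).

## Why this file

In the erratum road's typed records the VALUE AT `𝟙` of a BDP frame at route R1's ERRATUM data (one
non-split multiplicative `q ≠ p` with `E[p]` ramified, RAMIFIED in `K`; every other prime of `N_E`
split) is supplied from print by the registered fact `thm32_exists_isBDPLFunction_valueAtOne` (Cas18
Thms. 3.1–3.2), whose printed hypotheses carry `Squarefree N` and `5 ≤ p` — so every record that
needs the value (`…_of_thm32_…`, the `…_semistable_…` twins of `BDPRouteErratumDataRecord.lean`)
carries `Semistable W`. On the NON-semistable part of `R1Population` (census DATA, multr1-p1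
`census500k`, `N < 5·10⁵`, `p ≥ 5`: 679 006 of 1 234 205 class-wide pairs = 55.0 %) no printed or
typed supplier of the value exists, although the divisibility half has the same status there as on
the semistable part. This file ISOLATES the value as its own ∃-shape, binder for binder the twin of
`R1.IMCEqCoreFrameOnTree` (gen 25) with the value `R1.BDPValueAtOneOnTreeAt` in place of the
main-conjecture equality:

* §1 **`R1.BDPValueCoreFrameOnTree W p`** (H2∃⁻): at every datum (read through an infinite place `w₀`),
  every anticyclotomic `(κ, γ)`, every `ι'` and every `e : K → ℚ_p` inducing `𝔭_{ι'}`, THERE IS a frame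
  `(Ω_K ≠ 0, Ω_p ∈ R₀ˣ, L ∈ R₀⟦T⟧)` with Castella's interpolation property for `f_{Dt}` AND
  `L(𝟙) = u·((1 − a_p(E) p⁻¹)·log_{ω_E} P)²`, `u ∈ R₀ˣ`. This is, binder for binder, the statement
  THEOREM C♯ of cell bsd-stepL (PROOF-BDP §21: the ψ-free CLASSICAL `R₀`-frame of Castella–Hsieh
  2018 §3 under their hypothesis (Heeg′) «`N⁻` a square-free product of primes RAMIFIED in `K`» with
  `N⁻ = q`, every odd `p ∥ N`, any conductor) proves at memo level; the tree asserts nothing.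
* §2 `R1.bdpValueCoreFrameOnTree_of_thm32`: on SEMISTABLE pairs the shape is a THEOREM from the
  registered fact (so nothing typed before is lost).
* §3 the value-needing bridges of gens 22–25 with `(h32, Semistable W)` REPLACED by H2∃⁻:
  `R1.imcEqFrameOnTree_of_bdpValueCoreFrame_of_imcEqCoreFrame` (H2∃⁻ ∧ H3∃⁻ ⟹ H3∃),
  `R1.imcEqIntFrameOnTree_of_bdpValueCoreFrame_of_imcEqCoreFrame`,
  `R1.bdpValueAllFramesOnTree_of_bdpValueCoreFrame` (H2∃⁻ ⟹ H2∀′, given GZK + modularity for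
  `rank_ℤ E(K) = 1`), and `P2.imcDivIntFrameAtErratumData_of_bdpValueCoreFrame_of_core` (TARGET E of
  the cell = core one-sided shape + H2∃⁻) — all by VALUE RIGIDITY ACROSS PERIODS
  (`R1.bdpValueAtOneOnTreeAt_of_isBDPLFunction`, `R1.bdpValueAtOneIntAt_of_isBDPLFunctionInt`).
* §4 the records WITHOUT `Semistable W`: `R1.bsdp_of_bdpValueCoreFrame_of_imcEqCoreFrame_record`
  (route R1's record: 7 PUB + 5 cited + H2∃⁻ + H3∃⁻) and
  `P2.bsdp_of_r1Population_of_not_dvd_of_bdpValueCoreFrame_of_imcDivIntCoreFrameAtErratumData`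
  (the hybrid record on `R1Population ∩ {p ∤ ∏c}`: 11 PUB + 2 cited + H2∃⁻ + the value-free
  one-sided shape `P2.IMCDivIntCoreFrameAtErratumData`).

So on ALL of `R1Population ∩ {r_an = 1}` (any conductor) the erratum road's open inputs are exactly
TWO named shapes: H2∃⁻ (memo-level: THEOREM C♯; print on the semistable part) and the value-free
divisibility (PREPRINT-derived: [FW21, Thm. 4.41]; cell bsd-stepL's Road HF on the semistable part).
CONDITIONAL; nothing booked; labels UNCHANGED; X11b stays CONSTRUCTION-SHAPED.

References: [Castella2018] F. Castella, Camb. J. Math. 6 (2018), Thms. 2.3, 3.1, 3.2, §5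
(arXiv:1704.06608 pp. 5, 9, 12); [Castella2018Erratum] Thm. 1.1 (p. 1); [CastellaHsieh2018]
F. Castella, M.-L. Hsieh, Math. Ann. 370 (2018), §3.2–3.3 (hypothesis (Heeg′), Prop. 3.4, Def. 3.5,
Prop. 3.6; arXiv:1505.08165 pp. 9–11); [Hsieh2014] M.-L. Hsieh, Doc. Math. 19 (2014), Prop. 3.9,
Thm. 3.18; [KrizLi2019] D. Kriz, C. Li, Forum Math. Sigma 7 (2019) e15, §2; [FouquetWan2021] Thm. 4.41.
-/

noncomputable section

open scoped Classical

open WeierstrassCurve NumberField IsDedekindDomain Field PowerSeries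
open Literature.NumberTheory.EllipticCurves Literature.NumberTheory.EllipticCurves.GreenbergSelmer
open Literature.NumberTheory.EllipticCurves.ModularForms
open Literature.NumberTheory.EllipticCurves.Rank1Residual
open Literature.NumberTheory.EllipticCurves.Rank1Residual.Typed
open Literature.NumberTheory.EllipticCurves.Castella2018
open Literature.NumberTheory.GaloisRepresentations
open Literature.NumberTheory.GaloisCohomology
open Summit.BirchSwinnertonDyer.Rank1Residual.X11b.AcSelmer
open Summit.BirchSwinnertonDyer.Rank1Residual.X11b.Halves

namespace Summit.BirchSwinnertonDyer.Rank1Residual.X11b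

/-! ### §1 The shape H2∃⁻ (THEOREM C♯ of cell bsd-stepL, typed) -/

section Shape

variable (W : WeierstrassCurve ℚ) [W.IsElliptic] [W.IsGloballyMinimal] (p : ℕ) [Fact p.Prime]

/-- **H2∃⁻ — the value at `𝟙` of SOME BDP frame at every erratum datum of route R1 (typed shape; the
binders of `R1.IMCEqCoreFrameOnTree` VERBATIM, the conclusion's last conjunct replaced by the
value).** At every datum of route R1 (the erratum's A′-hypotheses `ErratumHypotheses W p`,
`ord_{s=1} L(E,s) = 1`, a non-split multiplicative `q ≠ p` with `E[p]` ramified at `q`, an erratum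
field `K` for `q` with [Cas20, §2.5]'s standing hypotheses at the tame level, a parametrisation datum
`Dt` at level `N_E` with `p ∤ c`, a Heegner datum `H`, a point `P` of infinite order reading the
Heegner point through the infinite place `w₀`), every anticyclotomic `(κ, γ)`, every `ι' : ℚ̄_p ≃ ℂ`
and every `e : K → ℚ_p` inducing `𝔭_{ι'}`: THERE IS a frame `(Ω_K ≠ 0, Ω_p ∈ R₀ˣ, L ∈ R₀⟦T⟧)` with
Castella's interpolation property `IsBDPLFunction ι' 𝔭_{ι'} κ γ f_{Dt} Ω_K Ω_p L` AND the value
`L(𝟙) = u·((1 − a_p(E) p⁻¹)·log_{ω_E} P)²`, `u ∈ R₀ˣ` (`R1.BDPValueAtOneOnTreeAt`, `ε_p = 0` since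
`p ∣ N_E`). On semistable pairs a THEOREM from the registered fact (§2, Cas18 Thms. 3.1–3.2); in
general it is the typed form of cell bsd-stepL's memo THEOREM C♯ (the ψ-free classical `R₀`-frame of
Castella–Hsieh 2018 §3 under (Heeg′) with `N⁻ = q`, every odd `p ∥ N`, any conductor), which the
tree does NOT assert. A predicate on `(W, p)`; every result using it is CONDITIONAL.
[cite: Castella2018, Thm. 3.1, display (3.2) and Thm. 3.2 (arXiv:1704.06608 p. 9) (shape only; nothing asserted)]
[cite: CastellaHsieh2018, §3.3 hypothesis (Heeg′), Prop. 3.4 and Def. 3.5 (arXiv:1505.08165 pp. 9–11) (the frame the memo uses; nothing asserted)] -/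
def R1.BDPValueCoreFrameOnTree : Prop :=
  ∀ [NeZero (W.conductorNorm ℤ)] (q : ℕ) [Fact q.Prime] (K : Type) [Field K] [NumberField K]
    (Dt : ModularParametrizationData W (W.conductorNorm ℤ))
    (H : HeegnerDatum (W.conductorNorm ℤ) (NumberField.discr K)) (w₀ : InfinitePlace K)
    (P : (W.baseChange K).toAffine.Point), ErratumHypotheses W p → W.analyticRank = 1 →
    q ≠ p → Mult W q → ¬ W.HasSplitMultiplicativeReductionAtPrime q →
    ¬ p ∣ padicValInt q W.minimalDiscriminantInt → IsErratumField W K q →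
    Cas20Standing K p (W.conductorNorm ℤ / p) →
    WeierstrassCurve.Affine.Point.map w₀.embedding.toRatAlgHom P = heegnerPointComplex Dt H →
    ¬ (p : ℤ) ∣ Dt.c → ¬ IsOfFinAddOrder P →
    ∀ (κ : ZpExtension K p), κ.IsAnticyclotomic →
      ∀ (γ : Field.absoluteGaloisGroup K) [Fact (κ.IsTopGenerator γ)] (ι' : PadicAlgCl p ≃+* ℂ)
        (e : K →+* ℚ_[p]),
        (∀ k : 𝓞 K, k ∈ (primeOfEmbeddingDatum p ι' w₀.embedding).asIdeal ↔ ‖e (k : K)‖ < 1) →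
        ∃ (ΩK : ℂ) (Ωp : (unrIntegers p)ˣ) (L : UnrSeries p), ΩK ≠ 0 ∧
          IsBDPLFunction ι' (primeOfEmbeddingDatum p ι' w₀.embedding) κ γ Dt.f ΩK
            ((Ωp : unrIntegers p) : ℂ_[p]) L ∧
          R1.BDPValueAtOneOnTreeAt W p e P L (W.LFunction p)

end Shape

/-! ### §2 On semistable pairs H2∃⁻ is a theorem from print -/

section FromPrint

variable {W : WeierstrassCurve ℚ} [W.IsElliptic] [W.IsGloballyMinimal] {p : ℕ} [Fact p.Prime]

/-- **H2∃⁻ on SEMISTABLE pairs from the registered fact** (Cas18 Thms. 3.1–3.2 instantiated at an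
erratum datum, multr1-p1's `R1.exists_frame_bdpValueAtOneOnTreeAt_of_thm32`): nothing typed before
is lost by isolating the value as a shape. CONDITIONAL on the published fact `h32`.
[cite: Castella2018, Thm. 3.1, display (3.2) and Thm. 3.2 (arXiv:1704.06608 p. 9)] -/
theorem R1.bdpValueCoreFrameOnTree_of_thm32 (h32 : thm32_exists_isBDPLFunction_valueAtOne)
    (hss : Semistable W) : R1.BDPValueCoreFrameOnTree W p := by
  intro _ q _ K _ _ Dt H w₀ P hE hr hqp hmq hns hvq hK hCas hP hc hinf κ hκ γ _ ι' e he
  exact R1.exists_frame_bdpValueAtOneOnTreeAt_of_thm32 h32 ι' Dt H hE hss hqp hK hc w₀ hP κ hκ γ he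

end FromPrint

/-! ### §3 The value-needing bridges with `(h32, Semistable W)` replaced by H2∃⁻ -/

section Bridges

variable {W : WeierstrassCurve ℚ} [W.IsElliptic] [W.IsGloballyMinimal] {p : ℕ} [Fact p.Prime]

/-- **H2∃⁻ ∧ H3∃⁻ ⟹ H3∃, on ANY pair**: at a datum, H3∃⁻ gives a frame `(Ω_K, Ω_p, L)` with
interpolation ∧ main-conjecture equality; H2∃⁻ gives a frame `(Ω_K', Ω_p', L')` of the SAME
`(ι', 𝔭_{ι'}, κ, γ, f_{Dt})` with the value at `𝟙`; by value rigidity across periods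
(`R1.bdpValueAtOneOnTreeAt_of_isBDPLFunction`: `K` is imaginary quadratic as an erratum field,
`p ≥ 5` is odd, periods non-zero) the value shape holds for `L` too. The semistable hypothesis of
gen 25's `R1.imcEqFrameOnTree_of_thm32_of_imcEqCoreFrame` is gone: it entered only through the
printed supplier of the value. CONDITIONAL on H2∃⁻ and H3∃⁻ (open).
[cite: Castella2018, Thm. 3.1, display (3.2) and Thm. 3.2 (arXiv:1704.06608 p. 9)]
[cite: Castella2018Erratum, Thm. 1.1 (p. 1)] -/
theorem R1.imcEqFrameOnTree_of_bdpValueCoreFrame_of_imcEqCoreFrame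
    (h2 : R1.BDPValueCoreFrameOnTree W p) (h3 : R1.IMCEqCoreFrameOnTree W p) :
    R1.IMCEqFrameOnTree W p := by
  intro _ q _ K _ _ Dt H w₀ P hE hr hqp hmq hns hvq hK hCas hP hc hinf κ hκ γ _ ι' e he
  obtain ⟨ΩK, Ωp, L, hΩ, hL, h3At⟩ :=
    h3 q K Dt H w₀ P hE hr hqp hmq hns hvq hK hCas hP hc hinf κ hκ γ ι' e he
  obtain ⟨ΩK', Ωp', L', hΩ', hL', h2'⟩ :=
    h2 q K Dt H w₀ P hE hr hqp hmq hns hvq hK hCas hP hc hinf κ hκ γ ι' e he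
  have hp2 : p ≠ 2 := hE.two_ne
  have hΩp : ((Ωp : unrIntegers p) : ℂ_[p]) ≠ 0 := by
    rw [Ne, ZeroMemClass.coe_eq_zero]
    exact Units.ne_zero Ωp
  have hΩp' : ((Ωp' : unrIntegers p) : ℂ_[p]) ≠ 0 := by
    rw [Ne, ZeroMemClass.coe_eq_zero]
    exact Units.ne_zero Ωp'
  exact ⟨ΩK, Ωp, L, hΩ, hL,
    R1.bdpValueAtOneOnTreeAt_of_isBDPLFunction hp2 hK.1 hκ hΩ hΩ' hΩp hΩp' hL hL' h2', h3At⟩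

/-- **H2∃⁻ ∧ H3∃⁻ ⟹ H3∃♭, on ANY pair** (through gen 23's `R1.imcEqIntFrameOnTree_of_imcEqFrame`).
CONDITIONAL on H2∃⁻ and H3∃⁻ (open). [cite: Castella2018, Thm. 3.1 and Thm. 3.2 (arXiv:1704.06608 p. 9)]
[cite: Castella2018Erratum, Thm. 1.1 (p. 1)] -/
theorem R1.imcEqIntFrameOnTree_of_bdpValueCoreFrame_of_imcEqCoreFrame
    (h2 : R1.BDPValueCoreFrameOnTree W p) (h3 : R1.IMCEqCoreFrameOnTree W p) :
    R1.IMCEqIntFrameOnTree W p :=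
  R1.imcEqIntFrameOnTree_of_imcEqFrame (R1.imcEqFrameOnTree_of_bdpValueCoreFrame_of_imcEqCoreFrame h2 h3)

/-- **H2∃⁻ ⟹ H2∀′ (the value at EVERY genuine frame of EVERY datum), on ANY pair, given GZK and
modularity** (for `rank_ℤ E(K) = 1` on the erratum field). Per datum: `f = f_{Dt}` (multiplicity one,
`IsNewformOf.unique`); the datum's `ι_K` is `w₀.embedding ∘ τ` for an involution `τ`
(`R1.exists_involution_map_eq`), so H2∃⁻ applies at `τ_* P` with the embedding `embAt K p 𝔭_{ι'}`
(which induces `𝔭_{ι'}`); VALUE RIGIDITY ACROSS PERIODS (`R1.bdpValueAtOneOnTreeAt_of_isBDPLFunction`)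
moves the value shape from the supplied frame to the given one; `(log_{ω_E} τ_* P)² = (log_{ω_E} P)²`
(`R1.bdpValueAtOneOnTreeAt_map_iff_of_rank_one`) moves it from `τ_* P` to `P`. This is gen 25's
`R1.bdpValueAllFramesOnTree_of_thm32` with its `(h32, Semistable W)` replaced by H2∃⁻. CONDITIONAL on
H2∃⁻ and the two published facts. [cite: Castella2018, Thm. 3.1, display (3.2) and Thm. 3.2 (arXiv:1704.06608 p. 9)] -/
theorem R1.bdpValueAllFramesOnTree_of_bdpValueCoreFrame (h2 : R1.BDPValueCoreFrameOnTree W p)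
    (hGZK : rank_eq_analyticRank_of_analyticRank_le_one) (hmod : exists_isNewformOf) :
    R1.BDPValueAllFramesOnTree W p := by
  intro _ q _ K _ _ Dt H ιK P hE hr hqp hmq hns hvq hK hCas hP hc hinf f hfW κ hκ γ _ ι' w₀ ΩK Ωp L
    hΩ hL
  obtain rfl : f = Dt.f := hfW.unique Dt.isNewformOf
  have hp2 : p ≠ 2 := hE.two_ne
  have hrk : (W.baseChange K).mordellWeilRank = 1 :=
    (IsErratumField.mordellWeilRank_eq_one_and_shaFinite W hGZK hmod hr hK).1
  obtain ⟨τ, hτ, hP', hinf'⟩ := R1.exists_involution_map_eq hK ιK w₀ Dt H hP hinf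
  -- THE embedding at `𝔭_{ι'}` induces `𝔭_{ι'}`
  have hemb := mem_asIdeal_iff_norm_embAt_lt_one (primeOfEmbeddingDatum p ι' w₀.embedding)
    (natCast_mem_primeOfEmbeddingDatum p ι' w₀.embedding)
    (degreeOne_primeOfEmbeddingDatum_of_isErratumField hK (dvd_conductorNorm_of_mult hE.2.1) hqp ι'
      w₀.embedding).1
    (degreeOne_primeOfEmbeddingDatum_of_isErratumField hK (dvd_conductorNorm_of_mult hE.2.1) hqp ι'
      w₀.embedding).2
  -- the supplied frame at `τ_* P`, with its value at `𝟙`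
  obtain ⟨ΩK', Ωp', L', hΩ', hL', h2'⟩ :=
    h2 q K Dt H w₀ _ hE hr hqp hmq hns hvq hK hCas hP' hc hinf' κ hκ γ ι' _ hemb
  have hΩp : ((Ωp : unrIntegers p) : ℂ_[p]) ≠ 0 := by
    rw [Ne, ZeroMemClass.coe_eq_zero]
    exact Units.ne_zero Ωp
  have hΩp' : ((Ωp' : unrIntegers p) : ℂ_[p]) ≠ 0 := by
    rw [Ne, ZeroMemClass.coe_eq_zero]
    exact Units.ne_zero Ωp'
  -- value rigidity across periods: the value shape at `τ_* P` holds for `L` too; then back to `P`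
  exact (R1.bdpValueAtOneOnTreeAt_map_iff_of_rank_one W p _ τ hτ hrk hinf L _).mp
    (R1.bdpValueAtOneOnTreeAt_of_isBDPLFunction hp2 hK.1 hκ hΩ hΩ' hΩp hΩp' hL hL' h2')

/-- **TARGET E of cell bsd-stepL from its two halves, on ANY pair: the value-free one-sided shape
`P2.IMCDivIntCoreFrameAtErratumData` ∧ H2∃⁻ ⟹ `P2.IMCDivIntFrameAtErratumData`.** At a datum the core
shape gives a ♭-frame `(Ω_K, Ω_p, Q)` with interpolation ∧ divisibility; H2∃⁻ gives a frame
`(Ω_K', Ω_p', L')` of the same data with the value at `𝟙`, read in `𝓞_{ℂ_p}⟦T⟧`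
(`R1.isBDPLFunctionInt_map`, `R1.bdpValueAtOneIntAt_map`); ♭-value rigidity across periods
(`R1.bdpValueAtOneIntAt_of_isBDPLFunctionInt`) moves the value to `Q`. This is multr1-p4's
`P2.imcDivIntFrameAtErratumData_of_thm32_of_core` with its `(h32, Semistable W)` replaced by H2∃⁻.
CONDITIONAL on both shapes (H2∃⁻: memo THEOREM C♯ ∕ print on semistable; the core shape:
PREPRINT-derived). [cite: Castella2018, Thm. 3.1, display (3.2) and Thm. 3.2 (arXiv:1704.06608 p. 9)]
[claim: Castella2018Erratum, status: under-review] -/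
theorem P2.imcDivIntFrameAtErratumData_of_bdpValueCoreFrame_of_core
    (h2 : R1.BDPValueCoreFrameOnTree W p) (h : P2.IMCDivIntCoreFrameAtErratumData W p) :
    P2.IMCDivIntFrameAtErratumData W p := by
  intro _ q _ K _ _ Dt H w₀ P hE hr hqp hmq hns hvq hK hCas hP hc hinf κ hκ γ _ ι' e he
  obtain ⟨ΩK, Ωp, Q, hΩ, hΩp, hQ, h3At⟩ :=
    h q K Dt H w₀ P hE hr hqp hmq hns hvq hK hCas hP hc hinf κ hκ γ ι' e he
  obtain ⟨ΩK', Ωp', L', hΩ', hL', h2'⟩ :=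
    h2 q K Dt H w₀ P hE hr hqp hmq hns hvq hK hCas hP hc hinf κ hκ γ ι' e he
  have hp2 : p ≠ 2 := hE.two_ne
  have hΩp0 : Ωp ≠ 0 := by
    intro h0
    rw [h0, norm_zero] at hΩp
    exact zero_ne_one hΩp
  have hΩp'0 : ((Ωp' : unrIntegers p) : ℂ_[p]) ≠ 0 := by
    rw [Ne, ZeroMemClass.coe_eq_zero]
    exact Units.ne_zero Ωp'
  exact ⟨ΩK, Ωp, Q, hΩ, hΩp, hQ,
    R1.bdpValueAtOneIntAt_of_isBDPLFunctionInt hp2 hK.1 hκ hΩ hΩ' hΩp0 hΩp'0 hQ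
      (R1.isBDPLFunctionInt_map hL') (R1.bdpValueAtOneIntAt_map h2'), h3At⟩

end Bridges

/-! ### §4 The records without the semistable hypothesis -/

section Record

variable {W : WeierstrassCurve ℚ} [W.IsElliptic] [W.IsGloballyMinimal] {p : ℕ} [Fact p.Prime]

/-- **Route R1 — THE RECORD FROM H2∃⁻ ∧ H3∃⁻ on ANY pair of `R1Population ∩ {r_an = 1}` (`p ≥ 5`;
7 PUBLISHED + 5 CITED + TWO typed inputs).** For every globally minimal elliptic `W/ℚ` and prime `p`
on `R1Population` with `ord_{s=1} L(E,s) = 1`: `BSD(E,p)`, from the SEVEN PUBLISHED named facts `hGZ`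
(Gross–Zagier 1986 I.7.3), `hGZK`, `hSk` (Skinner 2016 Thm. C), `hmod`, `hCST` (Cai–Shu–Tian 2014
Thm. 1.1), `hFH` (Friedberg–Hoffstein 1995 Thm. B), `hMaz` (Mazur 1978 Cor. 4.1), the FIVE CITED
cohomological facts `hPT hPT2 hEP hcd hBr`, and the TWO typed inputs H2∃⁻ (`R1.BDPValueCoreFrameOnTree`:
cell bsd-stepL's memo THEOREM C♯; print on the semistable part) and H3∃⁻ (`R1.IMCEqCoreFrameOnTree`:
erratum Thm. 1.1 typed with Thm. 3.1's characterisation, OPEN ⇐ [FW21, Thm. 4.41], PREPRINT). Gen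
25's record `R1.bsdp_of_thm32_of_imcEqCoreFrame_record` with `(h32, Semistable W)` replaced by H2∃⁻ —
through multr1-p1's `R1.bsdp_of_imcEqFrame_record`, which never needed semistability.
CONDITIONAL; deletes nothing; X11b stays CONSTRUCTION-SHAPED; no label change.
[cite: Castella2018, §5 (arXiv:1704.06608 p. 12)] [cite: Castella2018Erratum, Thm. 1.1, Thm. A′ (p. 1)] -/
theorem R1.bsdp_of_bdpValueCoreFrame_of_imcEqCoreFrame_record
    (hGZ : GrossZagier1986_thm_I_7_3) (hGZK : rank_eq_analyticRank_of_analyticRank_le_one)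
    (hSk : Skinner2016.thmC_padicValRat_bsd_rank_zero) (hmod : exists_isNewformOf)
    (hCST : CaiShuTian2014.thm11_trivialChar)
    (hFH : friedbergHoffstein_exists_twist_ne_zero_ramifiedAt)
    (hMaz : mazur_not_dvd_maninConstant_of_odd)
    (hPT : ∀ (K : Type) [Field K] [NumberField K], poitouTate_selmerStructure_duality K)
    (hPT2 : ∀ (K : Type) [Field K] [NumberField K], poitouTate_sha_tateDual K)
    (hEP : ∀ (K : Type) [Field K] [NumberField K] (v : HeightOneSpectrum (𝓞 K)),
      localEulerPoincareCharacteristic (v.adicCompletion K))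
    (hcd : fieldCdLE_two_of_numberField)
    (hBr : ∀ (K : Type) [Field K] [NumberField K] (p : ℕ) [Fact p.Prime],
      ZpExtension.decomp_not_le_kerSubgroup_of_isAnticyclotomic K p)
    (h2 : R1.BDPValueCoreFrameOnTree W p) (h3 : R1.IMCEqCoreFrameOnTree W p)
    (hW : R1Population W p) (hr : W.analyticRank = 1) : BSDp W p :=
  R1.bsdp_of_imcEqFrame_record hGZ hGZK hSk hmod hCST hFH hMaz hPT hPT2 hEP hcd hBr
    (R1.imcEqFrameOnTree_of_bdpValueCoreFrame_of_imcEqCoreFrame h2 h3) hW hr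

/-- **THE HYBRID RECORD on `R1Population ∩ {p ∤ ∏_ℓ c_ℓ(E)}` WITHOUT the semistable hypothesis
(`p ≥ 5`; 11 PUBLISHED + 2 CITED + TWO typed inputs).** `BSD(E,p)` from route R1's seven published
facts (`hGZ86 hGZK hSk hnf hCST hFH hMaz`), route p2's Euler-system-half facts at a classical Heegner
field (`hGZ hKo hB hHL`), the cited `hPT hEP`, and the TWO typed inputs H2∃⁻
(`R1.BDPValueCoreFrameOnTree`: memo THEOREM C♯ of cell bsd-stepL; print on the semistable part) and
the value-free ONE-SIDED shape `P2.IMCDivIntCoreFrameAtErratumData` ((2.4)♭ ⇐ [FW21, Thm. 4.41] +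
Hida descent, PREPRINT; cell bsd-stepL's Road HF on the semistable part). Multr1-p4's
`P2.bsdp_of_r1Population_semistable_of_not_dvd_of_imcDivIntCoreFrameAtErratumData` with
`(h32, Semistable W)` replaced by H2∃⁻. Census (DATA, multr1-p1 `census500k`, `N < 5·10⁵`): the
non-semistable part of `R1Population` it newly reaches (modulo the two shapes) is 679 006 of
1 234 205 class-wide pairs. CONDITIONAL; nothing booked; labels UNCHANGED; X11b stays
CONSTRUCTION-SHAPED. [cite: Castella2018, §5 (arXiv:1704.06608 p. 12)]
[cite: Castella2018Erratum, Thm. 1.1, Thm. A′ (p. 1)] -/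
theorem P2.bsdp_of_r1Population_of_not_dvd_of_bdpValueCoreFrame_of_imcDivIntCoreFrameAtErratumData
    (hGZ86 : GrossZagier1986_thm_I_7_3) (hGZK : rank_eq_analyticRank_of_analyticRank_le_one)
    (hSk : Skinner2016.thmC_padicValRat_bsd_rank_zero) (hnf : exists_isNewformOf)
    (hCST : CaiShuTian2014.thm11_trivialChar)
    (hFH : friedbergHoffstein_exists_twist_ne_zero_ramifiedAt)
    (hMaz : mazur_not_dvd_maninConstant_of_odd)
    (hGZ : ∀ (N : ℕ) [NeZero N] (W : WeierstrassCurve ℚ) (K : Type) [Field K] [NumberField K],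
      gross_zagier N W K)
    (hKo : ∀ (N : ℕ) [NeZero N] (W : WeierstrassCurve ℚ) (K : Type) [Field K] [NumberField K],
      kolyvagin N W K)
    (hB : ∀ (N : ℕ) [NeZero N] (W : WeierstrassCurve ℚ) (K : Type) [Field K] [NumberField K],
      Kolyvagin1990_padicValNat_card_sha_le N W K)
    (hHL : HoffsteinLuo1997_exists_twist_L_one_ne_zero)
    (hPT : ∀ (K : Type) [Field K] [NumberField K], poitouTate_sum_localTatePairing_eq_zero K)
    (hEP : ∀ (K : Type) [Field K] [NumberField K] (v : HeightOneSpectrum (𝓞 K)),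
      localEulerPoincareCharacteristic (v.adicCompletion K))
    (h2 : R1.BDPValueCoreFrameOnTree W p) (hD : P2.IMCDivIntCoreFrameAtErratumData W p)
    (hW : R1Population W p) (hr : W.analyticRank = 1) (htam : ¬ p ∣ W.tamagawaProduct) :
    BSDp W p :=
  P2.bsdp_of_r1Population_of_not_dvd_of_imcDivIntFrameAtErratumData W p hGZ86 hGZK hSk hnf hCST hFH
    hMaz hGZ hKo hB hHL hPT hEP (P2.imcDivIntFrameAtErratumData_of_bdpValueCoreFrame_of_core h2 hD) hW
    hr htam

end Record

end Summit.BirchSwinnertonDyer.Rank1Residual.X11b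

end
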